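import Summits.ValiantsHypothesis.ValiantsHypothesis.Theorems.SymPencilPerFourHessianMinors
import Summits.ValiantsHypothesis.ValiantsHypothesis.Theorems.SymPencilPerFourTwoRowsRadical
import Summits.ValiantsHypothesis.ValiantsHypothesis.Theorems.SymPencilBoxFourEquality
import Literature.Computability.AlgebraicComplexity.AlperBogartVelascoIsotropy
import Summits.ValiantsHypothesis.ValiantsHypothesis.Theorems.SymPencilBoxFourSeven

/-!
# Route `SymPencil` — Task T1 in the swapped reading: no `7`-dimensional singular subspace of
# `per_4` has `rank Hess per_4 ≤ 5`, given the `7`-dimensional trichotomy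
# (`Cruxes/SdcSuperquadratic/NEXT-RUNG-23.md`, Task T1; `--supports` stmt-ValiantsHypothesis-5674
# `SdcSuperquadratic`; rung currency only)

The SWAPPED property of a subspace `W ⊆ K^{4×4}` with `|ι|` squares: for every `y ∈ W` the
`s²`-coefficient of `s ↦ per_4 (u + s y)` is `Σ_{k ∈ ι} c_k Λ_k(u)²` with linear functionals `Λ_k`
of the base point `u` (so `rank (Hess per_4)(y) ≤ |ι|`).  Prover val-width-5674-p2's
`SymPencilPerFourHessianMinors.exists_perm_col_vanish_of_sum_sq_swap` extracts from `|ι| < 6`: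
for all rows `a ≠ b` and every column `m` some `2 × 2` subpermanent
`y_{ac} y_{bm} + y_{am} y_{bc}` (`c ≠ m`) vanishes identically on `W`.  This file turns that
into the three exclusions matching the `7`-dimensional trichotomy `T7` of prover
val-width-5676-p2 g3 (files `SymPencilBoxFourSeven*`):

* `false_of_detecting_rows_of_sum_sq_swap`: `dim W ≥ 7`, a DETECTING pair of rows `p, q`
  (`x ∈ W` with rows `p, q` zero is `0`) and the swapped property with `< 6` squares are
  contradictory — the subspace `W₀ ⊆ W` of elements whose rows `p, q` live on the two columns
  `m, c` has dimension `≥ 7 - 4 = 3` and injects (detection) into the four cells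
  `(p,c), (q,m), (p,m), (q,c)` as a totally isotropic subspace of the split quadric
  `x_{pc} x_{qm} + x_{pm} x_{qc}` on `K² × K²`, whose isotropic subspaces have dimension `≤ 2`
  (`AlperBogartVelasco.finrank_le_card_of_isotropic`);
* `false_of_detecting_cols_of_sum_sq_swap`: the same for a detecting pair of columns, by
  transposition (`sqFamilySwap_map`, the swapped twin of
  `SymPencilPerFourCoordinateRadical.sqFamily_map`);
* `false_of_cross_of_sum_sq_swap`: `W =` the cross `X_{lc}` (support in row `l ∪` column `c`) is
  contradictory — for rows `l, p` and column `c` the extracted subpermanent is `y_{lc'} y_{pc}`,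
  which does not vanish at `E_{lc'} + E_{pc} ∈ X_{lc}`.

Hence `noLowRank_seven_of_trichotomy`: GIVEN `T7` (as a hypothesis, in g3's shape), no
`7`-dimensional `V ⊆ Sing Z(per_4)` carries a swapped family with `5` squares — the statement
`T1` of the lane, which feeds `SymPencilSdcPerFourTwentyFive.twentyFive_le_of_noLowRank_seven`
(a second, S2-side discharge of the rung `sdc(per_4) ≥ 25`; the S1-side discharge is
val-width-5674-p1's `SymPencilSdcPerFourTwentyFiveOfSeven`).

Honest framing: bookkeeping on top of p2's minors lemma and g3's trichotomy; no new lower bound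
beyond what `T7` already gives; the crux `SdcSuperquadratic` stays open and `VP ≠ VNP` is not
moved.  No definitions, no named facts. [folklore]
-/

noncomputable section

-- single-conjunct layout: Sub = Summit, duplicated namespace component intended
set_option linter.dupNamespace false

namespace Summit.ValiantsHypothesis.ValiantsHypothesis.Theorems.SymPencilPerFourLowRankSeven

open Matrix MvPolynomial Module
open Literature.Computability.AlgebraicComplexity
open Literature.Computability.AlgebraicComplexity.AlperBogartVelasco
open Summit.ValiantsHypothesis.ValiantsHypothesis.Theorems.SymPencilPerFourHessianMinors
open Summit.ValiantsHypothesis.ValiantsHypothesis.Theorems.SymPencilPerFourTwoRowsRadical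
open Summit.ValiantsHypothesis.ValiantsHypothesis.Theorems.SymPencilBoxFourEquality

variable {K : Type*} [Field K]

/-! ### Transport of the swapped family -/

/-- **Transport of a swapped family of `|ι|`-square expansions along a `per_4`-preserving linear
automorphism** (row/column permutations, transposition): the functionals of the base point are
pulled back along `Φ⁻¹`. [folklore] -/
theorem sqFamilySwap_map {ι : Type*} [Fintype ι] (V : Submodule K (Fin 4 × Fin 4 → K))
    (Φ : (Fin 4 × Fin 4 → K) ≃ₗ[K] (Fin 4 × Fin 4 → K))
    (hΦ : ∀ z, eval (Φ z) (perPoly (Fin 4) K) = eval z (perPoly (Fin 4) K))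
    (hform : ∀ y ∈ V, ∃ (c : ι → K) (Λ : ι → ((Fin 4 × Fin 4 → K) →ₗ[K] K)),
      ∀ u : Fin 4 × Fin 4 → K, ∃ e₀ e₁ : K, ∀ s : K,
        eval (u + s • y) (perPoly (Fin 4) K) = e₀ + s * e₁ + s ^ 2 * ∑ k, c k * (Λ k u) ^ 2) :
    ∀ y ∈ V.map Φ.toLinearMap, ∃ (c : ι → K) (Λ : ι → ((Fin 4 × Fin 4 → K) →ₗ[K] K)),
      ∀ u : Fin 4 × Fin 4 → K, ∃ e₀ e₁ : K, ∀ s : K,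
        eval (u + s • y) (perPoly (Fin 4) K) = e₀ + s * e₁ + s ^ 2 * ∑ k, c k * (Λ k u) ^ 2 := by
  rintro _ ⟨x, hx, rfl⟩
  obtain ⟨c, Λ, he⟩ := hform x hx
  refine ⟨c, fun k => (Λ k).comp Φ.symm.toLinearMap, fun u => ?_⟩
  obtain ⟨e₀, e₁, h⟩ := he (Φ.symm u)
  refine ⟨e₀, e₁, fun s => ?_⟩
  have hu : u + s • Φ.toLinearMap x = Φ (Φ.symm u + s • x) := by
    rw [map_add, map_smul, LinearEquiv.apply_symm_apply]; rfl
  rw [hu, hΦ, h s]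
  refine congrArg (fun t => e₀ + s * e₁ + s ^ 2 * t) (Finset.sum_congr rfl fun k _ => ?_)
  rw [LinearMap.comp_apply, LinearEquiv.coe_toLinearMap]

/-! ### A detecting pair of rows -/

/-- The four columns of `Fin 4` containing two given distinct ones. [folklore] -/
theorem exists_other_two_cols (m c : Fin 4) (hcm : c ≠ m) :
    ∃ j₁ j₂ : Fin 4, ∀ j : Fin 4, j ≠ m → j ≠ c → j ≠ j₁ → j ≠ j₂ → False := by
  revert m c; decide

/-- **A detecting pair of rows is incompatible with `rank Hess per_4 ≤ 5` in dimension `≥ 7`.**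
If `dim W ≥ 7`, rows `p ≠ q` detect `W` (an element of `W` with rows `p, q` zero is zero) and
every `y ∈ W` has the swapped property with `|ι| < 6` squares, contradiction.  See the module
docstring. [folklore] -/
theorem false_of_detecting_rows_of_sum_sq_swap [CharZero K] {ι : Type*} [Fintype ι]
    (hι : Fintype.card ι < 6) (W : Submodule K (Fin 4 × Fin 4 → K)) (h7 : 7 ≤ finrank K W)
    {p q : Fin 4} (hpq : p ≠ q)
    (hdet : ∀ x ∈ W, (∀ j, x (p, j) = 0) → (∀ j, x (q, j) = 0) → x = 0)
    (hW : ∀ y ∈ W, ∃ (c : ι → K) (Λ : ι → ((Fin 4 × Fin 4 → K) →ₗ[K] K)),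
      ∀ u : Fin 4 × Fin 4 → K, ∃ e₀ e₁ : K, ∀ s : K,
        eval (u + s • y) (perPoly (Fin 4) K) = e₀ + s * e₁ + s ^ 2 * ∑ k, c k * (Λ k u) ^ 2) :
    False := by
  classical
  -- a `2 × 2` subpermanent of rows `p, q` through column `0` vanishing on `W`
  obtain ⟨c, hc0, hq⟩ := exists_perm_col_vanish_of_sum_sq_swap hι W hW p q 0 hpq
  obtain ⟨j₁, j₂, hcols⟩ := exists_other_two_cols 0 c hc0
  -- the other four cells of rows `p, q`
  let cell : Fin 4 → Fin 4 × Fin 4 := ![(p, j₁), (p, j₂), (q, j₁), (q, j₂)]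
  let ψ : (Fin 4 × Fin 4 → K) →ₗ[K] (Fin 4 → K) :=
    LinearMap.pi fun i => LinearMap.proj (cell i)
  have hψ : ∀ x i, ψ x i = x (cell i) := fun _ _ => rfl
  set W₀ : Submodule K (Fin 4 × Fin 4 → K) := W ⊓ LinearMap.ker ψ with hW₀def
  -- `dim W₀ ≥ 3`
  have hW₀3 : 3 ≤ finrank K W₀ := by
    have h := finrank_eq_finrank_map_add_finrank_inf_ker W ψ
    have hle : finrank K (W.map ψ) ≤ 4 :=
      ((W.map ψ).finrank_le).trans (by rw [finrank_fintype_fun_eq_card, Fintype.card_fin])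
    rw [hW₀def]
    omega
  have memW₀ : ∀ x ∈ W₀, x ∈ W ∧ x (p, j₁) = 0 ∧ x (p, j₂) = 0 ∧ x (q, j₁) = 0 ∧ x (q, j₂) = 0 := by
    intro x hx
    rw [hW₀def, Submodule.mem_inf, LinearMap.mem_ker] at hx
    refine ⟨hx.1, ?_, ?_, ?_, ?_⟩
    · simpa [hψ, cell] using congr_fun hx.2 0
    · simpa [hψ, cell] using congr_fun hx.2 1
    · simpa [hψ, cell] using congr_fun hx.2 2
    · simpa [hψ, cell] using congr_fun hx.2 3
  -- the four cells `(p,c), (p,0) | (q,0), (q,c)` as a point of `K² × K²`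
  let φ : (Fin 4 × Fin 4 → K) →ₗ[K] (Fin 2 → K) × (Fin 2 → K) :=
    LinearMap.prod (LinearMap.pi fun i => LinearMap.proj (![(p, c), (p, 0)] i))
      (LinearMap.pi fun i => LinearMap.proj (![(q, 0), (q, c)] i))
  have hφ1 : ∀ x, (φ x).1 = ![x (p, c), x (p, 0)] := fun x => by
    ext i; fin_cases i <;> rfl
  have hφ2 : ∀ x, (φ x).2 = ![x (q, 0), x (q, c)] := fun x => by
    ext i; fin_cases i <;> rfl
  have hdot : ∀ x x' : Fin 4 × Fin 4 → K,
      (φ x).1 ⬝ᵥ (φ x').2 = x (p, c) * x' (q, 0) + x (p, 0) * x' (q, c) := fun x x' => by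
    rw [hφ1, hφ2]
    simp [dotProduct, Fin.sum_univ_two]
  -- the image of `W₀` is totally isotropic for the split quadric
  set T := W₀.map φ with hTdef
  have hiso : ∀ z ∈ T, ∀ z' ∈ T, z.1 ⬝ᵥ z'.2 + z'.1 ⬝ᵥ z.2 = 0 := by
    rintro _ ⟨x, hx, rfl⟩ _ ⟨x', hx', rfl⟩
    have hxW := (memW₀ x hx).1
    have hx'W := (memW₀ x' hx').1
    have h1 := hq (x + x') (W.add_mem hxW hx'W)
    have h2 := hq x hxW
    have h3 := hq x' hx'W
    rw [hdot, hdot]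
    simp only [Pi.add_apply] at h1
    linear_combination h1 - h2 - h3
  have hT2 : finrank K T ≤ 2 := by
    have h := finrank_le_card_of_isotropic T hiso
    rwa [Fintype.card_fin] at h
  -- `φ` is injective on `W₀` (detection), so `dim T = dim W₀ ≥ 3`
  have hker : (W₀ ⊓ LinearMap.ker φ : Submodule K _) = ⊥ := by
    rw [eq_bot_iff]
    intro x hx
    rw [Submodule.mem_inf, LinearMap.mem_ker] at hx
    obtain ⟨hxW, hpj₁, hpj₂, hqj₁, hqj₂⟩ := memW₀ x hx.1
    have hpc : x (p, c) = 0 := by simpa [hφ1] using congr_fun (congr_arg Prod.fst hx.2) 0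
    have hp0 : x (p, 0) = 0 := by simpa [hφ1] using congr_fun (congr_arg Prod.fst hx.2) 1
    have hq0 : x (q, 0) = 0 := by simpa [hφ2] using congr_fun (congr_arg Prod.snd hx.2) 0
    have hqc : x (q, c) = 0 := by simpa [hφ2] using congr_fun (congr_arg Prod.snd hx.2) 1
    rw [Submodule.mem_bot]
    refine hdet x hxW (fun j => ?_) (fun j => ?_)
    · by_cases hjm : j = 0
      · rw [hjm]; exact hp0
      by_cases hjc : j = c
      · rw [hjc]; exact hpc
      by_cases hj1 : j = j₁
      · rw [hj1]; exact hpj₁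
      by_cases hj2 : j = j₂
      · rw [hj2]; exact hpj₂
      exact (hcols j hjm hjc hj1 hj2).elim
    · by_cases hjm : j = 0
      · rw [hjm]; exact hq0
      by_cases hjc : j = c
      · rw [hjc]; exact hqc
      by_cases hj1 : j = j₁
      · rw [hj1]; exact hqj₁
      by_cases hj2 : j = j₂
      · rw [hj2]; exact hqj₂
      exact (hcols j hjm hjc hj1 hj2).elim
  have hT : finrank K T = finrank K W₀ := by
    have h := finrank_eq_finrank_map_add_finrank_inf_ker W₀ φ
    rw [hker, finrank_bot, add_zero] at h
    rw [hTdef, ← h]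
  omega

/-! ### A detecting pair of columns -/

/-- **A detecting pair of columns is incompatible with `rank Hess per_4 ≤ 5` in dimension `≥ 7`**
(transpose of `false_of_detecting_rows_of_sum_sq_swap`). [folklore] -/
theorem false_of_detecting_cols_of_sum_sq_swap [CharZero K] {ι : Type*} [Fintype ι]
    (hι : Fintype.card ι < 6) (W : Submodule K (Fin 4 × Fin 4 → K)) (h7 : 7 ≤ finrank K W)
    {p q : Fin 4} (hpq : p ≠ q)
    (hdet : ∀ x ∈ W, (∀ i, x (i, p) = 0) → (∀ i, x (i, q) = 0) → x = 0)
    (hW : ∀ y ∈ W, ∃ (c : ι → K) (Λ : ι → ((Fin 4 × Fin 4 → K) →ₗ[K] K)),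
      ∀ u : Fin 4 × Fin 4 → K, ∃ e₀ e₁ : K, ∀ s : K,
        eval (u + s • y) (perPoly (Fin 4) K) = e₀ + s * e₁ + s ^ 2 * ∑ k, c k * (Λ k u) ^ 2) :
    False := by
  set Φ : (Fin 4 × Fin 4 → K) ≃ₗ[K] (Fin 4 × Fin 4 → K) :=
    LinearEquiv.funCongrLeft K K (Equiv.prodComm (Fin 4) (Fin 4)) with hΦ
  have hΦa : ∀ (x : Fin 4 × Fin 4 → K) (i j : Fin 4), Φ x (i, j) = x (j, i) := fun x i j => rfl
  have hW' := sqFamilySwap_map W Φ eval_perPoly_transpose hW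
  set W' := W.map Φ.toLinearMap with hW'def
  have hfin : finrank K W' = finrank K W := by rw [hW'def, LinearEquiv.finrank_map_eq]
  have hdet' : ∀ y ∈ W', (∀ j, y (p, j) = 0) → (∀ j, y (q, j) = 0) → y = 0 := by
    rintro _ ⟨x, hx, rfl⟩ h2 h3
    have hx0 : x = 0 := hdet x hx (fun i => h2 i) (fun i => h3 i)
    rw [hx0, map_zero]
  exact false_of_detecting_rows_of_sum_sq_swap hι W' (by rw [hfin]; exact h7) hpq hdet' hW'

/-! ### A cross -/

/-- **A cross is incompatible with `rank Hess per_4 ≤ 5`.**  If `W` is the cross `X_{lc}`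
(support in row `l ∪` column `c`) and every `y ∈ W` has the swapped property with `|ι| < 6`
squares, contradiction: for a row `p ≠ l` the extracted vanishing subpermanent of rows `l, p`
through column `c` is `y_{lc'} y_{pc}` (`c' ≠ c`), non-zero at `E_{lc'} + E_{pc} ∈ X_{lc}`.
[folklore] -/
theorem false_of_cross_of_sum_sq_swap [CharZero K] {ι : Type*} [Fintype ι]
    (hι : Fintype.card ι < 6) (W : Submodule K (Fin 4 × Fin 4 → K)) {l c : Fin 4}
    (hX : ∀ x, x ∈ W ↔ ∀ i j : Fin 4, i ≠ l → j ≠ c → x (i, j) = 0)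
    (hW : ∀ y ∈ W, ∃ (c : ι → K) (Λ : ι → ((Fin 4 × Fin 4 → K) →ₗ[K] K)),
      ∀ u : Fin 4 × Fin 4 → K, ∃ e₀ e₁ : K, ∀ s : K,
        eval (u + s • y) (perPoly (Fin 4) K) = e₀ + s * e₁ + s ^ 2 * ∑ k, c k * (Λ k u) ^ 2) :
    False := by
  classical
  obtain ⟨p, hpl⟩ : ∃ p : Fin 4, p ≠ l := ⟨l + 1, by simp⟩
  obtain ⟨c', hc'c, hq⟩ := exists_perm_col_vanish_of_sum_sq_swap hι W hW l p c hpl.symm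
  -- the test element `E_{lc'} + E_{pc}`
  let y : Fin 4 × Fin 4 → K := fun ij => if ij = (l, c') then 1 else if ij = (p, c) then 1 else 0
  have hy : y ∈ W := by
    rw [hX]
    intro i j hi hj
    have h1 : (i, j) ≠ (l, c') := fun h => hi (Prod.mk.inj h).1
    have h2 : (i, j) ≠ (p, c) := fun h => hj (Prod.mk.inj h).2
    simp [y, h1, h2]
  have h := hq y hy
  have hlc' : y (l, c') = 1 := by simp [y]
  have hpc : y (p, c) = 1 := by
    have hne : (p, c) ≠ (l, c') := fun h => hpl (Prod.mk.inj h).1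
    simp [y, hne]
  have hlc : y (l, c) = 0 := by
    have h1 : (l, c) ≠ (l, c') := fun h => hc'c (Prod.mk.inj h).2.symm
    have h2 : (l, c) ≠ (p, c) := fun h => hpl (Prod.mk.inj h).1.symm
    simp [y, h1, h2]
  rw [hlc', hpc, hlc] at h
  norm_num at h

/-! ### Assembly: `T7 ⇒ T1` -/

/-- **`T7 ⇒ T1` (swapped reading).**  Given the `7`-dimensional trichotomy (every `7`-dimensional
`W ⊆ Sing Z(per_4)` has a detecting pair of rows, or of columns, or is a cross), no
`7`-dimensional `V ⊆ Sing Z(per_4)` carries, for fixed weights `c : Fin 5 → K`, a swapped family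
of `5`-square expansions of the `s²`-coefficient — i.e. «no `7`-dim `V ⊆ Sing(per_4)` with
`rank Hess per_4 ≤ 5` on `V`», the hypothesis of
`SymPencilSdcPerFourTwentyFive.twentyFive_le_of_noLowRank_seven`. [folklore] -/
theorem noLowRank_seven_of_trichotomy [CharZero K]
    (T7 : ∀ W : Submodule K (Fin 4 × Fin 4 → K),
      (∀ x ∈ W, ∀ (r c : Fin 3 → Fin 4), Function.Injective r → Function.Injective c →
        ((Matrix.of fun i j => x (i, j)).submatrix r c).permanent = 0) →
      finrank K W = 7 →
      (∃ p q : Fin 4, p ≠ q ∧ ∀ x ∈ W, (∀ j, x (p, j) = 0) → (∀ j, x (q, j) = 0) → x = 0) ∨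
      (∃ p q : Fin 4, p ≠ q ∧ ∀ x ∈ W, (∀ i, x (i, p) = 0) → (∀ i, x (i, q) = 0) → x = 0) ∨
      (∃ l c : Fin 4, ∀ x, x ∈ W ↔ ∀ i j : Fin 4, i ≠ l → j ≠ c → x (i, j) = 0))
    (V : Submodule K (Fin 4 × Fin 4 → K))
    (hV3 : ∀ x ∈ V, ∀ (r c : Fin 3 → Fin 4), Function.Injective r → Function.Injective c →
      ((Matrix.of fun i j => x (i, j)).submatrix r c).permanent = 0)
    (h7 : finrank K V = 7) (c : Fin 5 → K) :
    ¬ (∀ y ∈ V, ∃ Λ : Fin 5 → ((Fin 4 × Fin 4 → K) →ₗ[K] K),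
        ∀ u : Fin 4 × Fin 4 → K, ∃ e₀ e₁ : K, ∀ s : K,
          eval (u + s • y) (perPoly (Fin 4) K) = e₀ + s * e₁ + s ^ 2 * ∑ k, c k * (Λ k u) ^ 2) := by
  intro hform
  have hW : ∀ y ∈ V, ∃ (c : Fin 5 → K) (Λ : Fin 5 → ((Fin 4 × Fin 4 → K) →ₗ[K] K)),
      ∀ u : Fin 4 × Fin 4 → K, ∃ e₀ e₁ : K, ∀ s : K,
        eval (u + s • y) (perPoly (Fin 4) K) = e₀ + s * e₁ + s ^ 2 * ∑ k, c k * (Λ k u) ^ 2 :=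
    fun y hy => ⟨c, hform y hy⟩
  have h5 : Fintype.card (Fin 5) < 6 := by rw [Fintype.card_fin]; norm_num
  rcases T7 V hV3 h7 with ⟨p, q, hpq, hdet⟩ | ⟨p, q, hpq, hdet⟩ | ⟨l, c₀, hX⟩
  · exact false_of_detecting_rows_of_sum_sq_swap h5 V (by rw [h7]) hpq hdet hW
  · exact false_of_detecting_cols_of_sum_sq_swap h5 V (by rw [h7]) hpq hdet hW
  · exact false_of_cross_of_sum_sq_swap h5 V hX hW


/-! ### `T1` unconditionally (appended once `SymPencilBoxFourSeven.seven_trichotomy` landed) -/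

/-- **Task T1, proved: no `7`-dimensional `V ⊆ Sing Z(per_4)` has `rank (Hess per_4) ≤ 5` on `V`.**
Precisely: for fixed weights `c : Fin 5 → K` there is no swapped family of `5`-square expansions of
the `s²`-coefficient of `per_4 (u + s y)` along a `7`-dimensional linear subspace of `Sing Z(per_4)`
(characteristic `0`).  From `noLowRank_seven_of_trichotomy` and the landed trichotomy
`SymPencilBoxFourSeven.seven_trichotomy_iff` (prover val-width-5676-p2 g3).  Composed with
`SymPencilSdcPerFourTwentyFive.twentyFive_le_of_noLowRank_seven` this is the S2-side proof of the
rung `sdc(per_4) ≥ 25` (the tree's unconditional statement is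
`SymPencilSdcPerFourTwentyFive.twentyFive_le_of_isSymm_isAffineDetRepr_perPoly_four`, S1 side).
[folklore] -/
theorem noLowRank_seven [CharZero K] (V : Submodule K (Fin 4 × Fin 4 → K))
    (hV3 : ∀ x ∈ V, ∀ (r c : Fin 3 → Fin 4), Function.Injective r → Function.Injective c →
      ((Matrix.of fun i j => x (i, j)).submatrix r c).permanent = 0)
    (h7 : finrank K V = 7) (c : Fin 5 → K) :
    ¬ (∀ y ∈ V, ∃ Λ : Fin 5 → ((Fin 4 × Fin 4 → K) →ₗ[K] K),
        ∀ u : Fin 4 × Fin 4 → K, ∃ e₀ e₁ : K, ∀ s : K,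
          eval (u + s • y) (perPoly (Fin 4) K) = e₀ + s * e₁ + s ^ 2 * ∑ k, c k * (Λ k u) ^ 2) :=
  noLowRank_seven_of_trichotomy
    (fun W hW hW7 => SymPencilBoxFourSeven.seven_trichotomy_iff W hW hW7) V hV3 h7 c

/-- **General-`ι` form of T1**: along a `7`-dimensional linear subspace of `Sing Z(per_4)` not every
direction has the swapped property with `< 6` squares (weights may depend on the direction).
[folklore] -/
theorem not_sum_sq_swap_seven [CharZero K] {ι : Type*} [Fintype ι] (hι : Fintype.card ι < 6)
    (V : Submodule K (Fin 4 × Fin 4 → K))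
    (hV3 : ∀ x ∈ V, ∀ (r c : Fin 3 → Fin 4), Function.Injective r → Function.Injective c →
      ((Matrix.of fun i j => x (i, j)).submatrix r c).permanent = 0)
    (h7 : finrank K V = 7) :
    ¬ (∀ y ∈ V, ∃ (c : ι → K) (Λ : ι → ((Fin 4 × Fin 4 → K) →ₗ[K] K)),
        ∀ u : Fin 4 × Fin 4 → K, ∃ e₀ e₁ : K, ∀ s : K,
          eval (u + s • y) (perPoly (Fin 4) K) = e₀ + s * e₁ + s ^ 2 * ∑ k, c k * (Λ k u) ^ 2) := by
  intro hW
  rcases SymPencilBoxFourSeven.seven_trichotomy_iff V hV3 h7 with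
    ⟨p, q, hpq, hdet⟩ | ⟨p, q, hpq, hdet⟩ | ⟨l, c₀, hX⟩
  · exact false_of_detecting_rows_of_sum_sq_swap hι V (by rw [h7]) hpq hdet hW
  · exact false_of_detecting_cols_of_sum_sq_swap hι V (by rw [h7]) hpq hdet hW
  · exact false_of_cross_of_sum_sq_swap hι V hX hW

end Summit.ValiantsHypothesis.ValiantsHypothesis.Theorems.SymPencilPerFourLowRankSeven

end
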